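import Mathlib
import Summits.NavierStokesRegularity.FunctionalMining.TopEigRayleigh
import HarnessLib

/-!
# DirectorForm — the DIRECTOR FORM of the sharp-class top eigenvalue, the kernel criterion (E)/(T1) and
# LEMMA W (twin walls are free)
# (nogo gen 24 staging `DirectorFormTension.STAGING.lean` 865f74d0478d10d4, §§1–3; filed by the prove seat in two
# parts under the 400-line cap: this file = §§1–3, `NoGo/DirectorFormTension.lean` = §§4–6; declarations and
# the namespace `…SharpClass.DirectorForm` are byte-identical to the staging file; `SIEVELD.md` §3.4b (6) Lemma W,
# (8f)(o) DIRECTOR FORM / (T1))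

search for candidate a priori estimates; no regularity claim.

Setting (prose dictionary, SIEVELD §3.4b (6)/(8)): the sharp class is `𝒦 = {K(n) := I − 3 n⊗n : |n| = 1}`
(the biaxial wells of the trace-free symmetric `3 × 3` tensors with top eigenvalue `λ₁ = 1`); a finite
polyhedral `𝒦`-configuration has constant wells `K(n_c)` on cells, and its unit mollification at a point is a
convex combination `S₁ = Σ_i θ_i K(n_i) = I − 3M`, `M := Σ_i θ_i n_i⊗n_i` (the second-moment tensor of the
local director mixture, `M ⪰ 0`, `tr M = 1`).  The cell's `λ₁` is the TOP RAYLEIGH VALUE `TopEig.lam` of the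
tree file `TopEigRayleigh` (`= λ_max` for symmetric tensors, `TopEigRayleighSpectral.lam_eq_eigenvalues₀`);
here it is transported to matrices: `lam1 M := TopEig.lam (flat M)`, `lamMin M := −lam1 (−M)`.

What is kernel-checked here (elementary linear algebra, `[ours]` = this cell's bookkeeping of folklore facts;
nothing below is specific to Navier–Stokes):
* §1 the matrix Rayleigh dictionary: `quad_flat` (`TopEig.quad (flat M) e = eᵀMe`), two-sided Rayleigh bounds
  for `lam1` / `lamMin`, compactness of the unit sphere and ATTAINMENT (`exists_ray_eq_lam1`,
  `exists_ray_eq_lamMin`), `lam1_smul_of_nonneg`, `lam1_add_smul_one`;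
* §2 the DIRECTOR FORM `lam1_one_sub_three_smul : λ₁(I − 3M) = 1 − 3 λ_min(M)` (EVERY matrix `M`, every
  nonempty finite index type), `sum_smul_well` (`Σ θ_i K(n_i) = I − 3·mix θ n` when `Σ θ_i = 1`), and the
  range facts `λ_min(M) ≥ 0` for `M ⪰ 0` (so `λ₁(S₁) ≤ 1`, `lam1_one_sub_three_smul_le_one`) and
  `card(d)·λ_min(M) ≤ tr M` (`card_mul_lamMin_le_trace`; so `λ₁(S₁) ≥ 0` when `tr M = 1` in dimension `3`,
  `lam1_one_sub_three_smul_nonneg`; `trace_mix`: `tr M = Σ θ_i |n_i|²`);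
* §3 the pointwise kernel criterion of (E)/(T1): `ray_mix` (`eᵀ(mix θ n)e = Σ θ_i (n_i·e)²`); for weights
  `θ_i ≥ 0`, a unit `v ⊥` every director gives `λ_min(M) = 0`, i.e. `λ₁(I − 3M) = 1`
  (`lam1_well_mix_eq_one_of_orthogonal`), and conversely for `θ_i > 0` (`lam1_well_mix_eq_one_iff`, via
  attainment); `exists_unit_orthogonal` (fewer directors than dimensions have a common unit normal —
  rank–nullity) and hence **LEMMA W of (6)** ('twin walls are free'; not the two-notch LEMMA W of the
  permissive book) `lemmaW`: in `ℝ³`, `λ₁(I − 3(θ₁ n₊⊗n₊ + θ₂ n₋⊗n₋)) = 1` for ALL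
  `θ₁, θ₂ ≥ 0` and all `n_±` — twin walls cost nothing at any thickness (`lemmaW_segment`: the two-cell form
  `λ₁((1−θ)K(n₋) + θK(n₊)) = 1`).
The quantitative bounds (T3), the wall algebra / MIRROR LAW (8)(M) (incl. `lam1_well`) and the deficit profile
(T2) are in `NoGo/DirectorFormTension.lean`.
NOT checked by Lean (prose, SIEVELD §3.4b (8f)): THEOREM T, the (⇒) half of the free-edge criterion (E), the
clause 'coplanar iff `s_e = 0`' of (T1), and anything about Navier–Stokes.  No verdict of the cell changes.
-/

noncomputable section

open Finset Set Matrix MeasureTheory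
open scoped Matrix ENNReal

namespace Summit.NavierStokesRegularity.FunctionalMining.SharpClass.DirectorForm

open TopEig

variable {d : Type*} [Fintype d]

/-! ## 1. Matrices as flattened tensors; top and bottom Rayleigh values -/

/-- A square matrix as a flattened tensor `A(i,j) = Mᵢⱼ` in `ℝ^{d×d}` (the carrier of `TopEig.lam`).
[ours, bookkeeping] -/
def flat (M : Matrix d d ℝ) : EuclideanSpace ℝ (d × d) := WithLp.toLp 2 fun p => M p.1 p.2

omit [Fintype d] in
/-- Entries of the flattened matrix. [ours] -/
@[simp] theorem flat_apply (M : Matrix d d ℝ) (i j : d) : flat M (i, j) = M i j := rfl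

/-- `TopEig.quad (flat M) e = eᵀ M e`. [folklore] -/
theorem quad_flat (M : Matrix d d ℝ) (e : d → ℝ) : quad (flat M) e = e ⬝ᵥ M *ᵥ e := by
  simp only [quad, dotProduct, Matrix.mulVec, Finset.mul_sum, flat_apply]
  exact Finset.sum_congr rfl fun i _ => Finset.sum_congr rfl fun j _ => by ring

/-- **Top Rayleigh value of a matrix**, `λ₁(M) := sup {eᵀMe : eᵀe = 1}` (`= λ_max` for symmetric `M`).
[ours, via `TopEig.lam`] -/
def lam1 (M : Matrix d d ℝ) : ℝ := lam (flat M)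

/-- **Bottom Rayleigh value**, `λ_min(M) := −λ₁(−M) = inf {eᵀMe : eᵀe = 1}`. [ours] -/
def lamMin (M : Matrix d d ℝ) : ℝ := -lam1 (-M)

/-- Rayleigh upper bound: `eᵀMe ≤ λ₁(M)` for unit `e`. [folklore] -/
theorem ray_le_lam1 (M : Matrix d d ℝ) {e : d → ℝ} (he : e ⬝ᵥ e = 1) : e ⬝ᵥ M *ᵥ e ≤ lam1 M := by
  rw [← quad_flat]; exact quad_le_lam _ he

/-- Rayleigh lower bound: `λ_min(M) ≤ eᵀMe` for unit `e`. [folklore] -/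
theorem lamMin_le_ray (M : Matrix d d ℝ) {e : d → ℝ} (he : e ⬝ᵥ e = 1) : lamMin M ≤ e ⬝ᵥ M *ᵥ e := by
  have h := ray_le_lam1 (-M) he
  rw [Matrix.neg_mulVec, dotProduct_neg] at h
  unfold lamMin; linarith

/-- `eᵀ(I − cM)e = eᵀe − c·eᵀMe`. [folklore] -/
theorem ray_one_sub_smul [DecidableEq d] (M : Matrix d d ℝ) (c : ℝ) (e : d → ℝ) :
    e ⬝ᵥ (1 - c • M) *ᵥ e = e ⬝ᵥ e - c * (e ⬝ᵥ M *ᵥ e) := by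
  rw [Matrix.sub_mulVec, Matrix.one_mulVec, Matrix.smul_mulVec, dotProduct_sub, dotProduct_smul,
    smul_eq_mul]

/-- The Rayleigh quotient `e ↦ eᵀMe` is continuous. [folklore] -/
theorem continuous_ray (M : Matrix d d ℝ) : Continuous fun e : d → ℝ => e ⬝ᵥ M *ᵥ e :=
  continuous_id.dotProduct (continuous_const.matrix_mulVec continuous_id)

/-- The unit sphere `{eᵀe = 1}` of `ℝ^d` is compact (closed and inside the sup-norm unit ball). [folklore] -/
theorem isCompact_unitSphere : IsCompact (unitSphere d) := by
  apply Metric.isCompact_of_isClosed_isBounded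
  · exact isClosed_eq (continuous_id.dotProduct continuous_id) continuous_const
  · rw [Metric.isBounded_iff_subset_closedBall (0 : d → ℝ)]
    refine ⟨1, fun e he => ?_⟩
    have h1 : e ⬝ᵥ e = 1 := he
    rw [mem_closedBall_zero_iff, pi_norm_le_iff_of_nonneg zero_le_one]
    intro i
    rw [Real.norm_eq_abs, abs_le_one_iff_mul_self_le_one, ← h1, dotProduct]
    exact Finset.single_le_sum (fun j _ => mul_self_nonneg (e j)) (Finset.mem_univ i)

variable [DecidableEq d] [Nonempty d]

/-- Least-upper-bound property: a uniform bound on unit Rayleigh values bounds `λ₁(M)`. [folklore] -/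
theorem lam1_le {M : Matrix d d ℝ} {c : ℝ} (h : ∀ e : d → ℝ, e ⬝ᵥ e = 1 → e ⬝ᵥ M *ᵥ e ≤ c) :
    lam1 M ≤ c :=
  lam_le fun e he => by rw [quad_flat]; exact h e he

/-- Greatest-lower-bound property of `λ_min`. [folklore] -/
theorem le_lamMin {M : Matrix d d ℝ} {c : ℝ} (h : ∀ e : d → ℝ, e ⬝ᵥ e = 1 → c ≤ e ⬝ᵥ M *ᵥ e) :
    c ≤ lamMin M := by
  have : lam1 (-M) ≤ -c :=
    lam1_le fun e he => by rw [Matrix.neg_mulVec, dotProduct_neg]; linarith [h e he]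
  unfold lamMin; linarith

/-- **Attainment**: `λ₁(M) = eᵀMe` for some unit `e` (extreme value theorem on the compact sphere).
[folklore] -/
theorem exists_ray_eq_lam1 (M : Matrix d d ℝ) : ∃ e : d → ℝ, e ⬝ᵥ e = 1 ∧ e ⬝ᵥ M *ᵥ e = lam1 M := by
  obtain ⟨e, he, hmax⟩ :=
    isCompact_unitSphere.exists_isMaxOn unitSphere_nonempty (continuous_ray M).continuousOn
  exact ⟨e, he, le_antisymm (ray_le_lam1 M he) (lam1_le fun f hf => isMaxOn_iff.mp hmax f hf)⟩

/-- **Attainment** of `λ_min`. [folklore] -/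
theorem exists_ray_eq_lamMin (M : Matrix d d ℝ) :
    ∃ e : d → ℝ, e ⬝ᵥ e = 1 ∧ e ⬝ᵥ M *ᵥ e = lamMin M := by
  obtain ⟨e, he, h⟩ := exists_ray_eq_lam1 (-M)
  refine ⟨e, he, ?_⟩
  rw [Matrix.neg_mulVec, dotProduct_neg] at h
  unfold lamMin; linarith

/-- `λ_min(M) ≤ λ₁(M)`. [folklore] -/
theorem lamMin_le_lam1 (M : Matrix d d ℝ) : lamMin M ≤ lam1 M := by
  obtain ⟨e, he, -⟩ := exists_ray_eq_lam1 M
  exact (lamMin_le_ray M he).trans (ray_le_lam1 M he)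

/-- Positive homogeneity: `λ₁(cM) = c λ₁(M)` for `c ≥ 0`. [folklore] -/
theorem lam1_smul_of_nonneg {c : ℝ} (hc : 0 ≤ c) (M : Matrix d d ℝ) : lam1 (c • M) = c * lam1 M := by
  refine le_antisymm (lam1_le fun e he => ?_) ?_
  · rw [Matrix.smul_mulVec, dotProduct_smul, smul_eq_mul]
    exact mul_le_mul_of_nonneg_left (ray_le_lam1 M he) hc
  · obtain ⟨e, he, h⟩ := exists_ray_eq_lam1 M
    rw [← h, ← smul_eq_mul, ← dotProduct_smul, ← Matrix.smul_mulVec]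
    exact ray_le_lam1 _ he

/-- Shift by the identity: `λ₁(M + a I) = λ₁(M) + a`. [folklore] -/
theorem lam1_add_smul_one (M : Matrix d d ℝ) (a : ℝ) : lam1 (M + a • (1 : Matrix d d ℝ)) = lam1 M + a := by
  have hray : ∀ e : d → ℝ, e ⬝ᵥ e = 1 → e ⬝ᵥ (M + a • (1 : Matrix d d ℝ)) *ᵥ e = e ⬝ᵥ M *ᵥ e + a := by
    intro e he
    rw [Matrix.add_mulVec, Matrix.smul_mulVec, Matrix.one_mulVec, dotProduct_add, dotProduct_smul, he,
      smul_eq_mul, mul_one]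
  refine le_antisymm (lam1_le fun e he => ?_) ?_
  · rw [hray e he]; linarith [ray_le_lam1 M he]
  · obtain ⟨e, he, h⟩ := exists_ray_eq_lam1 M
    rw [← h, ← hray e he]; exact ray_le_lam1 _ he

/-! ## 2. The DIRECTOR FORM `λ₁(I − 3M) = 1 − 3 λ_min(M)` -/

/-- **DIRECTOR FORM** (SIEVELD §3.4b (8f)): for every matrix `M`, `λ₁(I − 3M) = 1 − 3 λ_min(M)`. [ours] -/
theorem lam1_one_sub_three_smul (M : Matrix d d ℝ) :
    lam1 (1 - (3 : ℝ) • M) = 1 - 3 * lamMin M := by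
  refine le_antisymm (lam1_le fun e he => ?_) ?_
  · rw [ray_one_sub_smul, he]; linarith [lamMin_le_ray M he]
  · obtain ⟨e, he, h⟩ := exists_ray_eq_lamMin M
    have := ray_le_lam1 (1 - (3 : ℝ) • M) he
    rw [ray_one_sub_smul, he, h] at this
    exact this

/-- `M ⪰ 0` (as a quadratic form) gives `λ_min(M) ≥ 0`. [folklore] -/
theorem lamMin_nonneg_of_psd {M : Matrix d d ℝ} (hM : ∀ e : d → ℝ, 0 ≤ e ⬝ᵥ M *ᵥ e) : 0 ≤ lamMin M :=
  le_lamMin fun e _ => hM e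

/-- Hence `λ₁(I − 3M) ≤ 1` for `M ⪰ 0`: the mollified sharp class never exceeds the wells' value `1`. [ours] -/
theorem lam1_one_sub_three_smul_le_one {M : Matrix d d ℝ} (hM : ∀ e : d → ℝ, 0 ≤ e ⬝ᵥ M *ᵥ e) :
    lam1 (1 - (3 : ℝ) • M) ≤ 1 := by
  rw [lam1_one_sub_three_smul]; linarith [lamMin_nonneg_of_psd hM]

omit [Nonempty d] in
/-- `λ_min(M) ≤ Mᵢᵢ` (test the coordinate vector). [folklore] -/
theorem lamMin_le_diag (M : Matrix d d ℝ) (i : d) : lamMin M ≤ M i i := by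
  have h := lamMin_le_ray M (single_mem_unitSphere (d := d) i)
  rwa [← quad_flat, quad_single, flat_apply] at h

omit [Nonempty d] in
/-- `(card d) · λ_min(M) ≤ tr M`. [folklore] -/
theorem card_mul_lamMin_le_trace (M : Matrix d d ℝ) : (Fintype.card d : ℝ) * lamMin M ≤ M.trace := by
  have h : ∑ _i : d, lamMin M ≤ ∑ i : d, M i i := Finset.sum_le_sum fun i _ => lamMin_le_diag M i
  rw [Finset.sum_const, Finset.card_univ, nsmul_eq_mul] at h
  simpa [Matrix.trace] using h

/-- The well `K(n) := I − 3 n⊗n` of a director `n` (an element of `𝒦` when `|n| = 1`). [ours, bookkeeping] -/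
def well (n : d → ℝ) : Matrix d d ℝ := 1 - (3 : ℝ) • vecMulVec n n

section ThreeD

/-- In dimension `3`: `3 λ_min(M) ≤ tr M`, so `tr M = 1` gives `λ₁(I − 3M) ≥ 0`
(`S₁ = I − 3M` is trace-free and `λ₁ ≥ 0` on trace-free tensors). [ours] -/
theorem lam1_one_sub_three_smul_nonneg {M : Matrix (Fin 3) (Fin 3) ℝ} (htr : M.trace = 1) :
    0 ≤ lam1 (1 - (3 : ℝ) • M) := by
  have h := card_mul_lamMin_le_trace M
  rw [Fintype.card_fin, htr] at h
  rw [lam1_one_sub_three_smul]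
  push_cast at h
  linarith

end ThreeD

/-! ## 3. Director mixtures, the kernel criterion (E)/(T1) and LEMMA W -/

variable {ι : Type*} [Fintype ι]

omit [DecidableEq d] [Nonempty d] in
/-- The second-moment tensor `M = Σ_i θ_i n_i⊗n_i` of a weighted director family. [ours, bookkeeping] -/
def mix (θ : ι → ℝ) (n : ι → d → ℝ) : Matrix d d ℝ := ∑ i, θ i • vecMulVec (n i) (n i)

omit [DecidableEq d] [Nonempty d] in
/-- `eᵀ(a⊗b)e = (a·e)(b·e)`. [folklore] -/
theorem ray_vecMulVec (a b e : d → ℝ) : e ⬝ᵥ vecMulVec a b *ᵥ e = (a ⬝ᵥ e) * (b ⬝ᵥ e) := by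
  simp only [dotProduct, Matrix.mulVec, vecMulVec_apply]
  rw [Finset.sum_mul]
  refine Finset.sum_congr rfl fun i _ => ?_
  rw [Finset.mul_sum, Finset.mul_sum]
  exact Finset.sum_congr rfl fun j _ => by ring

omit [DecidableEq d] [Nonempty d] in
/-- `eᵀ M e = Σ_i θ_i (n_i·e)²` for the mixture `M = mix θ n`. [ours] -/
theorem ray_mix (θ : ι → ℝ) (n : ι → d → ℝ) (e : d → ℝ) :
    e ⬝ᵥ mix θ n *ᵥ e = ∑ i, θ i * (n i ⬝ᵥ e) ^ 2 := by
  simp only [mix, Matrix.sum_mulVec, dotProduct_sum, Matrix.smul_mulVec, dotProduct_smul, smul_eq_mul,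
    ray_vecMulVec, sq]

omit [DecidableEq d] [Nonempty d] in
/-- Nonnegative weights give `M ⪰ 0`. [ours] -/
theorem ray_mix_nonneg {θ : ι → ℝ} (hθ : ∀ i, 0 ≤ θ i) (n : ι → d → ℝ) (e : d → ℝ) :
    0 ≤ e ⬝ᵥ mix θ n *ᵥ e := by
  rw [ray_mix]; exact Finset.sum_nonneg fun i _ => mul_nonneg (hθ i) (sq_nonneg _)

omit [Fintype d] [Nonempty d] in
/-- `Σ_i θ_i K(n_i) = I − 3 M` when the weights sum to `1` (the mollified configuration takes values in
`conv 𝒦 ∋ I − 3M`). [ours] -/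
theorem sum_smul_well {θ : ι → ℝ} (hθ : ∑ i, θ i = 1) (n : ι → d → ℝ) :
    ∑ i, θ i • well (n i) = 1 - (3 : ℝ) • mix θ n := by
  have h1 : ∑ i, θ i • (1 : Matrix d d ℝ) = 1 := by rw [← Finset.sum_smul, hθ, one_smul]
  calc ∑ i, θ i • well (n i)
      = ∑ i, (θ i • (1 : Matrix d d ℝ) - (3 : ℝ) • (θ i • vecMulVec (n i) (n i))) :=
        Finset.sum_congr rfl fun i _ => by rw [well, smul_sub, smul_comm]
    _ = 1 - (3 : ℝ) • mix θ n := by rw [Finset.sum_sub_distrib, h1, mix, Finset.smul_sum]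

omit [DecidableEq d] [Nonempty d] in
/-- The trace of the mixture: `tr M = Σ_i θ_i |n_i|²` (`= 1` for unit directors and `Σ θ_i = 1`). [ours] -/
theorem trace_mix (θ : ι → ℝ) (n : ι → d → ℝ) : (mix θ n).trace = ∑ i, θ i * (n i ⬝ᵥ n i) := by
  simp only [mix, Matrix.trace_sum, Matrix.trace_smul, Matrix.trace_vecMulVec, smul_eq_mul]

/-- `λ_min(M) ≥ 0` for nonnegative weights. [ours] -/
theorem lamMin_mix_nonneg {θ : ι → ℝ} (hθ : ∀ i, 0 ≤ θ i) (n : ι → d → ℝ) : 0 ≤ lamMin (mix θ n) :=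
  le_lamMin fun e _ => ray_mix_nonneg hθ n e

/-- **Kernel criterion, (E)(⇐)/(T1) pointwise**: a unit vector orthogonal to every director of a
nonnegative mixture gives `λ_min(M) = 0`. [ours] -/
theorem lamMin_mix_eq_zero_of_orthogonal {θ : ι → ℝ} (hθ : ∀ i, 0 ≤ θ i) {n : ι → d → ℝ} {v : d → ℝ}
    (hv : v ⬝ᵥ v = 1) (hperp : ∀ i, n i ⬝ᵥ v = 0) : lamMin (mix θ n) = 0 := by
  refine le_antisymm ?_ (lamMin_mix_nonneg hθ n)
  have h := lamMin_le_ray (mix θ n) hv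
  rw [ray_mix] at h
  simpa [hperp] using h

/-- … equivalently `λ₁(I − 3M) = 1`: such points are FREE (cells, twin walls, free junction cores). [ours] -/
theorem lam1_well_mix_eq_one_of_orthogonal {θ : ι → ℝ} (hθ : ∀ i, 0 ≤ θ i) {n : ι → d → ℝ}
    {v : d → ℝ} (hv : v ⬝ᵥ v = 1) (hperp : ∀ i, n i ⬝ᵥ v = 0) :
    lam1 (1 - (3 : ℝ) • mix θ n) = 1 := by
  rw [lam1_one_sub_three_smul, lamMin_mix_eq_zero_of_orthogonal hθ hv hperp]; ring

/-- **Converse for positive weights** (attainment): `λ_min(M) = 0` with all `θ_i > 0` forces a unit vector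
orthogonal to every director (the directors are coplanar in `ℝ³`). [ours] -/
theorem exists_orthogonal_of_lamMin_mix_eq_zero {θ : ι → ℝ} (hθ : ∀ i, 0 < θ i) {n : ι → d → ℝ}
    (h0 : lamMin (mix θ n) = 0) : ∃ v : d → ℝ, v ⬝ᵥ v = 1 ∧ ∀ i, n i ⬝ᵥ v = 0 := by
  obtain ⟨v, hv, hmin⟩ := exists_ray_eq_lamMin (mix θ n)
  refine ⟨v, hv, fun i => ?_⟩
  rw [h0, ray_mix] at hmin
  have hi := (Finset.sum_eq_zero_iff_of_nonneg fun j _ => mul_nonneg (hθ j).le (sq_nonneg _)).mp hmin i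
    (Finset.mem_univ i)
  rcases mul_eq_zero.mp hi with h | h
  · exact absurd h (hθ i).ne'
  · exact (pow_eq_zero_iff two_ne_zero).mp h

/-- **(T1) pointwise, iff form**: for positive weights, `λ₁(I − 3M) = 1` iff the directors have a common
unit normal. [ours] -/
theorem lam1_well_mix_eq_one_iff {θ : ι → ℝ} (hθ : ∀ i, 0 < θ i) (n : ι → d → ℝ) :
    lam1 (1 - (3 : ℝ) • mix θ n) = 1 ↔ ∃ v : d → ℝ, v ⬝ᵥ v = 1 ∧ ∀ i, n i ⬝ᵥ v = 0 := by
  constructor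
  · intro h
    rw [lam1_one_sub_three_smul] at h
    exact exists_orthogonal_of_lamMin_mix_eq_zero hθ (by linarith)
  · rintro ⟨v, hv, hperp⟩
    exact lam1_well_mix_eq_one_of_orthogonal (fun i => (hθ i).le) hv hperp

omit [DecidableEq d] [Nonempty d] in
/-- The pairing map `e ↦ (n_i · e)_i`. [ours, bookkeeping] -/
def pairing (n : ι → d → ℝ) : (d → ℝ) →ₗ[ℝ] (ι → ℝ) where
  toFun e i := n i ⬝ᵥ e
  map_add' e f := funext fun i => dotProduct_add (n i) e f
  map_smul' c e := funext fun i => by simp [dotProduct_smul]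

omit [DecidableEq d] [Nonempty d] in
/-- **Fewer directors than dimensions have a common unit normal** (rank–nullity for `pairing n`).
[folklore] -/
theorem exists_unit_orthogonal (n : ι → d → ℝ) (hcard : Fintype.card ι < Fintype.card d) :
    ∃ v : d → ℝ, v ⬝ᵥ v = 1 ∧ ∀ i, n i ⬝ᵥ v = 0 := by
  have hker : LinearMap.ker (pairing n) ≠ ⊥ :=
    LinearMap.ker_ne_bot_of_finrank_lt (by simpa [Module.finrank_fintype_fun_eq_card] using hcard)
  obtain ⟨e, he, hne⟩ := (Submodule.ne_bot_iff _).mp hker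
  have hperp : ∀ i, n i ⬝ᵥ e = 0 := fun i => congr_fun (LinearMap.mem_ker.mp he) i
  have hpos : 0 < e ⬝ᵥ e :=
    lt_of_le_of_ne (dotProduct_self_nonneg' e) (Ne.symm (mt dotProduct_self_eq_zero.mp hne))
  set c : ℝ := Real.sqrt (e ⬝ᵥ e) with hc
  have hcc : c * c = e ⬝ᵥ e := Real.mul_self_sqrt hpos.le
  have hc0 : c ≠ 0 := (Real.sqrt_pos.mpr hpos).ne'
  refine ⟨c⁻¹ • e, ?_, fun i => by rw [dotProduct_smul, hperp i, smul_zero]⟩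
  rw [smul_dotProduct, dotProduct_smul, smul_eq_mul, smul_eq_mul, ← hcc]
  field_simp

/-- **LEMMA W (twin walls are free)**, SIEVELD §3.4b (6): in `ℝ³`, along the whole segment between two wells
— indeed for ANY weights `θ₁, θ₂ ≥ 0` and any two directors — `λ₁(I − 3(θ₁ n₊⊗n₊ + θ₂ n₋⊗n₋)) = 1`:
the bracket has the kernel vector `n₊ × n₋` (a common unit normal exists since `2 < 3`). [ours] -/
theorem lemmaW {θ₁ θ₂ : ℝ} (h₁ : 0 ≤ θ₁) (h₂ : 0 ≤ θ₂) (np nm : Fin 3 → ℝ) :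
    lam1 (1 - (3 : ℝ) • (θ₁ • vecMulVec np np + θ₂ • vecMulVec nm nm)) = 1 := by
  have hmix : θ₁ • vecMulVec np np + θ₂ • vecMulVec nm nm = mix ![θ₁, θ₂] ![np, nm] := by
    simp [mix, Fin.sum_univ_two]
  obtain ⟨v, hv, hperp⟩ := exists_unit_orthogonal ![np, nm] (by simp)
  rw [hmix]
  exact lam1_well_mix_eq_one_of_orthogonal (fun i => by fin_cases i <;> simp [h₁, h₂]) hv hperp

/-- LEMMA W in the two-cell form `λ₁((1−θ)K(n₋) + θK(n₊)) = 1`, `θ ∈ [0,1]`. [ours] -/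
theorem lemmaW_segment {θ : ℝ} (h0 : 0 ≤ θ) (h1 : θ ≤ 1) (np nm : Fin 3 → ℝ) :
    lam1 ((1 - θ) • well nm + θ • well np) = 1 := by
  have h : (1 - θ) • well nm + θ • well np
      = 1 - (3 : ℝ) • (θ • vecMulVec np np + (1 - θ) • vecMulVec nm nm) := by
    simp only [well, smul_sub, smul_smul]
    ext i j
    simp [Matrix.sub_apply, Matrix.add_apply, Matrix.smul_apply]
    ring
  rw [h]
  exact lemmaW h0 (by linarith) np nm

end Summit.NavierStokesRegularity.FunctionalMining.SharpClass.DirectorForm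

end
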